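import Mathlib
import Literature.Computability.AlgebraicComplexity.RectangularExponentHomogeneity
import Literature.Computability.AlgebraicComplexity.RectangularExponentAsymptoticRank
import Literature.Computability.AlgebraicComplexity.RectangularExponentBounds
import Literature.Computability.AlgebraicComplexity.KroneckerRank

/-!
# MatrixMultiplication / ShapeSubmodularity — `ShapeSubmodular`, the decomposition bound
# (monotonicity and sublinearity of the rectangular exponent, in rank form)

Route `ShapeSubmodularity`, crux `ShapeSubmodular` (stmt-MatrixMultiplication-15622), line
`registered` (RESHAPE 7), stub `stub_decompositionBound`.

Write `R⟨k, m, l⟩ = tensorRank (matMulTensor ℂ k m l)` and call a real `β` *admissible* for the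
natural format `X = (x, y, z) ∈ ℕ³` when `R⟨n^x, n^y, n^z⟩ = O(n^β)`.  The stub is the rank form
of "`ω(a,b,c)` is monotone and sublinear": if `k · X ≤ Σᵢ cᵢ · Yᵢ` coordinatewise (five natural
formats `Yᵢ = (xᵢ, yᵢ, zᵢ)`, natural weights `cᵢ`, `k ≥ 1`) and `βᵢ` is admissible for `Yᵢ`, then
`(Σᵢ cᵢ βᵢ) / k` is admissible for `X`.

Proof.
* MULTIPLES (`decomp_isBigO_smul`): `R⟨n^{cu}, n^{cv}, n^{cw}⟩ ≤ R⟨n^u, n^v, n^w⟩^c` (Kronecker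
  powers, `tensorRank_matMulTensor_pow_le₃`), so `β` admissible for `(u,v,w)` gives `cβ`
  admissible for `c · (u,v,w)` (`IsBigO.pow`);
* SUMS (`decomp_isBigO_add`): `R⟨n^{u+u'}, n^{v+v'}, n^{w+w'}⟩ ≤ R⟨n^u,n^v,n^w⟩ · R⟨n^{u'},n^{v'},n^{w'}⟩`
  (Kronecker products, `Blaser2013_rank_matMulTensor_mul_le`), so admissible exponents add
  (`IsBigO.mul`); chaining, `B := Σᵢ cᵢ βᵢ` is admissible for `Σᵢ cᵢ Yᵢ`;
* PADDING (`decomp_isBigO_mono`): `R` is monotone in the three dimensions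
  (`tensorRank_matMulTensor_mono₃`), so `B` is admissible for `k · X ≤ Σᵢ cᵢ Yᵢ`;
* ROOTS (`decomp_isBigO_root`): `⌈n^a⌉ = n^a` for natural `a` (`rectDim_natCast`) identifies
  admissibility for `k · X` with `B ∈ rectAdmissibleExponents ℂ (kx) (ky) (kz)`; admissible
  exponents are `≥ 0` (`rectAdmissibleExponents_nonneg`) and homogeneity
  (`div_mem_rectAdmissibleExponents_of_smul`: pad `m` up to a `k`-th power) gives
  `B / k ∈ rectAdmissibleExponents ℂ x y z`, i.e. `R⟨n^x, n^y, n^z⟩ = O(n^{B/k})`.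
-/

-- (single-conjunct summit: the namespace repeats MatrixMultiplication)
set_option linter.dupNamespace false

open Filter Asymptotics
open Literature.Computability.AlgebraicComplexity

namespace Summit.MatrixMultiplication.MatrixMultiplication.Theorems.ShapeSubmodular

/-! ## `O`-bookkeeping: multiples, sums, padding, roots of natural formats -/

/-- Multiples of a format: `R⟨n^{cu}, n^{cv}, n^{cw}⟩ ≤ R⟨n^u, n^v, n^w⟩^c` (Kronecker powers), so
`β` admissible for `(u,v,w)` gives `cβ` admissible for `(cu, cv, cw)`. [folklore] -/
private theorem decomp_isBigO_smul (c : ℕ) {u v w : ℕ} {β : ℝ}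
    (h : (fun n : ℕ => (tensorRank (matMulTensor ℂ (n ^ u) (n ^ v) (n ^ w)) : ℝ)) =O[atTop]
      fun n : ℕ => (n : ℝ) ^ β) :
    (fun n : ℕ => (tensorRank (matMulTensor ℂ (n ^ (c * u)) (n ^ (c * v)) (n ^ (c * w))) : ℝ))
      =O[atTop] fun n : ℕ => (n : ℝ) ^ ((c : ℝ) * β) := by
  have h1 : (fun n : ℕ =>
      (tensorRank (matMulTensor ℂ (n ^ (c * u)) (n ^ (c * v)) (n ^ (c * w))) : ℝ)) =O[atTop]
      fun n : ℕ => (tensorRank (matMulTensor ℂ (n ^ u) (n ^ v) (n ^ w)) : ℝ) ^ c := by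
    refine IsBigO.of_bound 1 (Eventually.of_forall fun n => ?_)
    rw [one_mul, Real.norm_of_nonneg (Nat.cast_nonneg _), Real.norm_of_nonneg (by positivity)]
    calc (tensorRank (matMulTensor ℂ (n ^ (c * u)) (n ^ (c * v)) (n ^ (c * w))) : ℝ)
        = tensorRank (matMulTensor ℂ ((n ^ u) ^ c) ((n ^ v) ^ c) ((n ^ w) ^ c)) := by
          rw [tensorRank_matMulTensor_congr ℂ (pow_mul' n c u) (pow_mul' n c v) (pow_mul' n c w)]
      _ ≤ ((tensorRank (matMulTensor ℂ (n ^ u) (n ^ v) (n ^ w)) ^ c : ℕ) : ℝ) := by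
          exact_mod_cast tensorRank_matMulTensor_pow_le₃ ℂ (n ^ u) (n ^ v) (n ^ w) c
      _ = (tensorRank (matMulTensor ℂ (n ^ u) (n ^ v) (n ^ w)) : ℝ) ^ c := Nat.cast_pow _ _
  have h2 : (fun n : ℕ => (tensorRank (matMulTensor ℂ (n ^ u) (n ^ v) (n ^ w)) : ℝ) ^ c) =O[atTop]
      fun n : ℕ => ((n : ℝ) ^ β) ^ c := h.pow c
  have h3 : (fun n : ℕ => ((n : ℝ) ^ β) ^ c) =ᶠ[atTop] fun n : ℕ => (n : ℝ) ^ ((c : ℝ) * β) :=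
    Eventually.of_forall fun n => show ((n : ℝ) ^ β) ^ c = (n : ℝ) ^ ((c : ℝ) * β) by
      rw [mul_comm (c : ℝ) β, Real.rpow_mul_natCast (Nat.cast_nonneg _)]
  exact (h1.trans h2).trans h3.isBigO

/-- Sums of formats: `R⟨n^{u+u'}, n^{v+v'}, n^{w+w'}⟩ ≤ R⟨n^u, n^v, n^w⟩ · R⟨n^{u'}, n^{v'}, n^{w'}⟩`
(Kronecker products), so admissible exponents add. [folklore] -/
private theorem decomp_isBigO_add {u v w u' v' w' : ℕ} {β β' : ℝ}
    (h : (fun n : ℕ => (tensorRank (matMulTensor ℂ (n ^ u) (n ^ v) (n ^ w)) : ℝ)) =O[atTop]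
      fun n : ℕ => (n : ℝ) ^ β)
    (h' : (fun n : ℕ => (tensorRank (matMulTensor ℂ (n ^ u') (n ^ v') (n ^ w')) : ℝ)) =O[atTop]
      fun n : ℕ => (n : ℝ) ^ β') :
    (fun n : ℕ =>
      (tensorRank (matMulTensor ℂ (n ^ (u + u')) (n ^ (v + v')) (n ^ (w + w'))) : ℝ)) =O[atTop]
      fun n : ℕ => (n : ℝ) ^ (β + β') := by
  have h1 : (fun n : ℕ =>
      (tensorRank (matMulTensor ℂ (n ^ (u + u')) (n ^ (v + v')) (n ^ (w + w'))) : ℝ)) =O[atTop]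
      fun n : ℕ => (tensorRank (matMulTensor ℂ (n ^ u) (n ^ v) (n ^ w)) : ℝ) *
        (tensorRank (matMulTensor ℂ (n ^ u') (n ^ v') (n ^ w')) : ℝ) := by
    refine IsBigO.of_bound 1 (Eventually.of_forall fun n => ?_)
    rw [one_mul, Real.norm_of_nonneg (Nat.cast_nonneg _), Real.norm_of_nonneg (by positivity)]
    calc (tensorRank (matMulTensor ℂ (n ^ (u + u')) (n ^ (v + v')) (n ^ (w + w'))) : ℝ)
        = tensorRank (matMulTensor ℂ (n ^ u * n ^ u') (n ^ v * n ^ v') (n ^ w * n ^ w')) := by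
          rw [tensorRank_matMulTensor_congr ℂ (pow_add n u u') (pow_add n v v') (pow_add n w w')]
      _ ≤ ((tensorRank (matMulTensor ℂ (n ^ u) (n ^ v) (n ^ w)) *
            tensorRank (matMulTensor ℂ (n ^ u') (n ^ v') (n ^ w')) : ℕ) : ℝ) := by
          exact_mod_cast
            Blaser2013_rank_matMulTensor_mul_le ℂ (n ^ u) (n ^ v) (n ^ w) (n ^ u') (n ^ v') (n ^ w')
      _ = (tensorRank (matMulTensor ℂ (n ^ u) (n ^ v) (n ^ w)) : ℝ) *
            (tensorRank (matMulTensor ℂ (n ^ u') (n ^ v') (n ^ w')) : ℝ) := Nat.cast_mul _ _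
  have h2 := h.mul h'
  have h3 : (fun n : ℕ => (n : ℝ) ^ β * (n : ℝ) ^ β') =ᶠ[atTop]
      fun n : ℕ => (n : ℝ) ^ (β + β') := by
    filter_upwards [eventually_gt_atTop 0] with n hn0
    rw [Real.rpow_add (Nat.cast_pos.2 hn0)]
  exact (h1.trans h2).trans h3.isBigO

/-- Padding: for `u ≤ u'`, `v ≤ v'`, `w ≤ w'` and `n ≥ 1`,
`R⟨n^u, n^v, n^w⟩ ≤ R⟨n^{u'}, n^{v'}, n^{w'}⟩` (zero-padding in the three dimensions), so every
`O`-bound of the larger format is one of the smaller. [folklore] -/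
private theorem decomp_isBigO_mono {u v w u' v' w' : ℕ} (hu : u ≤ u') (hv : v ≤ v') (hw : w ≤ w')
    {g : ℕ → ℝ}
    (h : (fun n : ℕ => (tensorRank (matMulTensor ℂ (n ^ u') (n ^ v') (n ^ w')) : ℝ)) =O[atTop] g) :
    (fun n : ℕ => (tensorRank (matMulTensor ℂ (n ^ u) (n ^ v) (n ^ w)) : ℝ)) =O[atTop] g := by
  refine IsBigO.trans (IsBigO.of_bound 1 ?_) h
  filter_upwards [eventually_ge_atTop 1] with n hn
  rw [one_mul, Real.norm_of_nonneg (Nat.cast_nonneg _), Real.norm_of_nonneg (Nat.cast_nonneg _)]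
  exact_mod_cast tensorRank_matMulTensor_mono₃ ℂ (Nat.pow_le_pow_right hn hu)
    (Nat.pow_le_pow_right hn hv) (Nat.pow_le_pow_right hn hw)

/-- Roots of formats (`k ≥ 1`): if `R⟨n^{kx}, n^{ky}, n^{kz}⟩ = O(n^B)` then
`R⟨n^x, n^y, n^z⟩ = O(n^{B/k})`.  With `⌈n^a⌉ = n^a` for natural `a` the hypothesis says
`B ∈ rectAdmissibleExponents ℂ (kx) (ky) (kz)`, whence `B ≥ 0` and, by homogeneity of the
rectangular exponents (pad `m` up to the `k`-th power `⌈m^{1/k}⌉^k ≤ 2^k m`),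
`B / k ∈ rectAdmissibleExponents ℂ x y z`. [folklore] -/
private theorem decomp_isBigO_root {k : ℕ} (hk : 1 ≤ k) (x y z : ℕ) {B : ℝ}
    (h : (fun n : ℕ =>
      (tensorRank (matMulTensor ℂ (n ^ (k * x)) (n ^ (k * y)) (n ^ (k * z))) : ℝ)) =O[atTop]
      fun n : ℕ => (n : ℝ) ^ B) :
    (fun n : ℕ => (tensorRank (matMulTensor ℂ (n ^ x) (n ^ y) (n ^ z)) : ℝ)) =O[atTop]
      fun n : ℕ => (n : ℝ) ^ (B / k) := by
  -- the dictionary `⌈n^{k a}⌉ = n^{k a}`, `⌈n^a⌉ = n^a`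
  have e : ∀ a n : ℕ, rectDim n ((k : ℝ) * (a : ℝ)) = n ^ (k * a) := fun a n => by
    rw [← Nat.cast_mul, rectDim_natCast]
  have hmem : B ∈ rectAdmissibleExponents ℂ ((k : ℝ) * x) ((k : ℝ) * y) ((k : ℝ) * z) := by
    rw [rectAdmissibleExponents, Set.mem_setOf_eq]
    have ef : (fun n : ℕ => (tensorRank (matMulTensor ℂ (rectDim n ((k : ℝ) * x))
        (rectDim n ((k : ℝ) * y)) (rectDim n ((k : ℝ) * z))) : ℝ)) =
        fun n : ℕ => (tensorRank (matMulTensor ℂ (n ^ (k * x)) (n ^ (k * y)) (n ^ (k * z))) : ℝ) :=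
      funext fun n => by rw [tensorRank_matMulTensor_congr ℂ (e x n) (e y n) (e z n)]
    rw [ef]
    exact h
  have hB : 0 ≤ B := rectAdmissibleExponents_nonneg ℂ hmem
  have hres := div_mem_rectAdmissibleExponents_of_smul ℂ hk (Nat.cast_nonneg x) (Nat.cast_nonneg y)
    (Nat.cast_nonneg z) hB hmem
  rw [rectAdmissibleExponents, Set.mem_setOf_eq] at hres
  have ef' : (fun n : ℕ => (tensorRank (matMulTensor ℂ (rectDim n (x : ℝ)) (rectDim n (y : ℝ))
      (rectDim n (z : ℝ))) : ℝ)) =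
      fun n : ℕ => (tensorRank (matMulTensor ℂ (n ^ x) (n ^ y) (n ^ z)) : ℝ) :=
    funext fun n => by
      rw [tensorRank_matMulTensor_congr ℂ (rectDim_natCast n x) (rectDim_natCast n y)
        (rectDim_natCast n z)]
  rw [ef'] at hres
  exact hres

/-! ## The stub -/

/-- **The decomposition bound** (stub `stub_decompositionBound` of the line `registered` of crux
`ShapeSubmodular`; the rank form of "the rectangular exponent is monotone and sublinear"): if
`k · (x,y,z) ≤ Σᵢ cᵢ · (xᵢ,yᵢ,zᵢ)` coordinatewise (`i = 1,…,5`, natural weights `cᵢ`, `k ≥ 1`) and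
`R⟨n^{xᵢ}, n^{yᵢ}, n^{zᵢ}⟩ = O(n^{βᵢ})` for each `i`, then
`R⟨n^x, n^y, n^z⟩ = O(n^{(Σᵢ cᵢ βᵢ)/k})`.  Multiples and sums of formats multiply the ranks
(Kronecker powers and products: `Σᵢ cᵢ βᵢ` is admissible for `Σᵢ cᵢ Yᵢ`), padding transfers
this to `k · X`, and homogeneity of the rectangular exponents takes the `k`-th root. [folklore] -/
theorem stub_decompositionBound :
    ∀ x y z k : ℕ, 1 ≤ k →
      ∀ c₁ c₂ c₃ c₄ c₅ : ℕ, ∀ x₁ y₁ z₁ x₂ y₂ z₂ x₃ y₃ z₃ x₄ y₄ z₄ x₅ y₅ z₅ : ℕ, ∀ β₁ β₂ β₃ β₄ β₅ : ℝ,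
      k * x ≤ c₁ * x₁ + c₂ * x₂ + c₃ * x₃ + c₄ * x₄ + c₅ * x₅ →
      k * y ≤ c₁ * y₁ + c₂ * y₂ + c₃ * y₃ + c₄ * y₄ + c₅ * y₅ →
      k * z ≤ c₁ * z₁ + c₂ * z₂ + c₃ * z₃ + c₄ * z₄ + c₅ * z₅ →
      (fun n : ℕ => (Literature.Computability.AlgebraicComplexity.tensorRank
          (Literature.Computability.AlgebraicComplexity.matMulTensor ℂ (n ^ x₁) (n ^ y₁) (n ^ z₁)) : ℝ))
            =O[Filter.atTop] (fun n : ℕ => (n : ℝ) ^ β₁) →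
      (fun n : ℕ => (Literature.Computability.AlgebraicComplexity.tensorRank
          (Literature.Computability.AlgebraicComplexity.matMulTensor ℂ (n ^ x₂) (n ^ y₂) (n ^ z₂)) : ℝ))
            =O[Filter.atTop] (fun n : ℕ => (n : ℝ) ^ β₂) →
      (fun n : ℕ => (Literature.Computability.AlgebraicComplexity.tensorRank
          (Literature.Computability.AlgebraicComplexity.matMulTensor ℂ (n ^ x₃) (n ^ y₃) (n ^ z₃)) : ℝ))
            =O[Filter.atTop] (fun n : ℕ => (n : ℝ) ^ β₃) →
      (fun n : ℕ => (Literature.Computability.AlgebraicComplexity.tensorRank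
          (Literature.Computability.AlgebraicComplexity.matMulTensor ℂ (n ^ x₄) (n ^ y₄) (n ^ z₄)) : ℝ))
            =O[Filter.atTop] (fun n : ℕ => (n : ℝ) ^ β₄) →
      (fun n : ℕ => (Literature.Computability.AlgebraicComplexity.tensorRank
          (Literature.Computability.AlgebraicComplexity.matMulTensor ℂ (n ^ x₅) (n ^ y₅) (n ^ z₅)) : ℝ))
            =O[Filter.atTop] (fun n : ℕ => (n : ℝ) ^ β₅) →
      (fun n : ℕ => (Literature.Computability.AlgebraicComplexity.tensorRank
          (Literature.Computability.AlgebraicComplexity.matMulTensor ℂ (n ^ x) (n ^ y) (n ^ z)) : ℝ))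
            =O[Filter.atTop] (fun n : ℕ => (n : ℝ) ^ (((c₁ : ℝ) * β₁ + (c₂ : ℝ) * β₂ + (c₃ : ℝ) * β₃ + (c₄ : ℝ) * β₄ + (c₅ : ℝ) * β₅) / (k : ℝ))) := by
  intro x y z k hk c₁ c₂ c₃ c₄ c₅ x₁ y₁ z₁ x₂ y₂ z₂ x₃ y₃ z₃ x₄ y₄ z₄ x₅ y₅ z₅ β₁ β₂ β₃ β₄ β₅
    hx hy hz h₁ h₂ h₃ h₄ h₅
  -- `Σᵢ cᵢ βᵢ` is admissible for the format `Σᵢ cᵢ (xᵢ, yᵢ, zᵢ)` (multiples, then sums)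
  have hsum := decomp_isBigO_add (decomp_isBigO_add (decomp_isBigO_add (decomp_isBigO_add
    (decomp_isBigO_smul c₁ h₁) (decomp_isBigO_smul c₂ h₂)) (decomp_isBigO_smul c₃ h₃))
    (decomp_isBigO_smul c₄ h₄)) (decomp_isBigO_smul c₅ h₅)
  -- pad `k (x,y,z)` up to `Σᵢ cᵢ (xᵢ, yᵢ, zᵢ)`, then take the `k`-th root
  exact decomp_isBigO_root hk x y z (decomp_isBigO_mono hx hy hz hsum)

end Summit.MatrixMultiplication.MatrixMultiplication.Theorems.ShapeSubmodular
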